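import Summits.MatrixMultiplication.MatrixMultiplication.Theorems.ObstructionDescentUniversalOccurrenceSix

set_option linter.dupNamespace false
set_option autoImplicit false

/-!
# Universal occurrence — letter exchange in three-column tableaux (route `ObstructionDescent`, kernel K16, part 1 of 3)

Support file for the crux `NoOccurrenceObstruction` (`P_O`, item `stmt-MatrixMultiplication-29040`) of
`Summit.MatrixMultiplication.MatrixMultiplication.Theses.ObstructionDescent`.  This part holds the combinatorial plumbing
of the **three-column law** (stated and proved in `…UniversalOccurrenceThreeColumns`, cells in `…ThreeColumnsCells`):

* §1 `swap_comp_eq_comp_swap_three` — exchanging two letters `x ≠ y` with three preimages each under a label map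
  `I : [d] → [r]` equals pre-composing `I` with three position transpositions;
* §2 `threeCol_pairing_letterSwap`, `exists_colSorted_fibre` — for a standard tableau `T` and letters filling one cell in
  each of the columns `0, 1, 2` of `T`, the elementary pairing `⟨⊗_m M_{I m}, e_T⟩` changes sign under `x ↔ y`
  (`(−1)³`, tree `sum_prod_mul_polytabloid_comp_swap`);
* §3 `sum_eq_zero_of_letterSwap_invol` — the abstract sign-reversing involution "exchange a chosen pair of good letters"
  (`Finset.sum_involution`), the public form of the private plumbing of the tree's proof of BI 2011 Lemma 6.1
  (`UnitTensorSLObstructionsProofs`).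

The mechanism — exchanging two symbols is one transposition per slice/column — is that of Bürgisser–Ikenmeyer 2011,
Lemma 6.1, of Bürgisser–Ikenmeyer 2017, Prop. 5.22(2) and of Amanov–Yeliussizov 2022, Lemma 7.11.  All theorems, no `def`.

References: P. Bürgisser, C. Ikenmeyer, STOC 2011 / arXiv:1011.1350 [key BurgisserIkenmeyer2011], Lemma 6.1; P. Bürgisser,
C. Ikenmeyer, J. Algebra 477 (2017) / arXiv:1511.02927 [key BurgisserIkenmeyer2017], Prop. 5.22; A. Amanov, D. Yeliussizov,
arXiv:2202.11059 [key AmanovYeliussizov2022], Lemma 7.11; P. Bürgisser, C. Ikenmeyer, STOC 2013 [key BurgisserIkenmeyer2013], §4.2.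
-/

noncomputable section

open scoped BigOperators

namespace Summit.MatrixMultiplication.MatrixMultiplication.Theorems.ObstructionCalculus

open Literature.Computability.AlgebraicComplexity (kroneckerPow isotypicSum₁ isotypicSum₂ isotypicSum₃ unitTensor actTensor triad
  exists_pairing_ne_zero_of_isotypicSum₁₂₃_kroneckerPow_ne_zero card_parts_le_of_isotypicSum₁₂₃_kroneckerPow_ne_zero
  pairing_unitTensor_eq_sum sum_prod_mul_polytabloid_comp_swap sum_prod_mul_polytabloid_eq_zero_of_apply_eq
  sum_prod_mul_sum_smul_polytabloid exists_sum_smul_polytabloid_eq)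
open Literature.NumberTheory.DiophantineGeometry (Word wordRep highestWeightSpace Weight StdFilling ydWeight
  ydWeight_youngDiagram fst_lt_of_mem_youngDiagram kroneckerCoeff)
open Literature.RepresentationTheory.FiniteGroups.MNEval (kronSum kroneckerCoeff_pos_iff_kronSum_pos
  kroneckerCoeff_eq_kronSum_div)

/-! ## §1  Exchanging two letters with three preimages each = three position transpositions -/

/-- If the letters `x ≠ y` have exactly the preimages `{p₀, p₁, p₂}` and `{q₀, q₁, q₂}` under `I : [d] → [r]`, then
exchanging the letters `x ↔ y` after `I` is the same as exchanging the positions `p₀ ↔ q₀`, `p₁ ↔ q₁`, `p₂ ↔ q₂`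
before `I` (any matching of the two fibres will do). [folklore] -/
theorem swap_comp_eq_comp_swap_three {d r : ℕ} (I : Fin d → Fin r) {x y : Fin r} (hxy : x ≠ y)
    {p₀ p₁ p₂ q₀ q₁ q₂ : Fin d} (hp₀₁ : p₀ ≠ p₁) (hp₀₂ : p₀ ≠ p₂) (hp₁₂ : p₁ ≠ p₂)
    (hq₀₁ : q₀ ≠ q₁) (hq₀₂ : q₀ ≠ q₂) (hq₁₂ : q₁ ≠ q₂)
    (hx : ∀ m, I m = x ↔ (m = p₀ ∨ m = p₁ ∨ m = p₂)) (hy : ∀ m, I m = y ↔ (m = q₀ ∨ m = q₁ ∨ m = q₂)) :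
    ⇑(Equiv.swap x y) ∘ I = I ∘ ⇑(Equiv.swap p₀ q₀) ∘ ⇑(Equiv.swap p₁ q₁) ∘ ⇑(Equiv.swap p₂ q₂) := by
  have hIp₀ : I p₀ = x := (hx p₀).2 (Or.inl rfl)
  have hIp₁ : I p₁ = x := (hx p₁).2 (Or.inr (Or.inl rfl))
  have hIp₂ : I p₂ = x := (hx p₂).2 (Or.inr (Or.inr rfl))
  have hIq₀ : I q₀ = y := (hy q₀).2 (Or.inl rfl)
  have hIq₁ : I q₁ = y := (hy q₁).2 (Or.inr (Or.inl rfl))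
  have hIq₂ : I q₂ = y := (hy q₂).2 (Or.inr (Or.inr rfl))
  -- the two fibres are disjoint
  have hne : ∀ {p q : Fin d}, I p = x → I q = y → p ≠ q := fun hp hq h => hxy (by rw [← hp, h, hq])
  funext m
  simp only [Function.comp_apply]
  rcases eq_or_ne m p₂ with rfl | hm₁
  · rw [Equiv.swap_apply_left, Equiv.swap_apply_of_ne_of_ne (hne hIp₁ hIq₂).symm hq₁₂.symm,
      Equiv.swap_apply_of_ne_of_ne (hne hIp₀ hIq₂).symm hq₀₂.symm, hIq₂, hIp₂, Equiv.swap_apply_left]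
  rcases eq_or_ne m q₂ with rfl | hm₂
  · rw [Equiv.swap_apply_right, Equiv.swap_apply_of_ne_of_ne hp₁₂.symm (hne hIp₂ hIq₁),
      Equiv.swap_apply_of_ne_of_ne hp₀₂.symm (hne hIp₂ hIq₀), hIp₂, hIq₂, Equiv.swap_apply_right]
  rw [Equiv.swap_apply_of_ne_of_ne hm₁ hm₂]
  rcases eq_or_ne m p₁ with rfl | hm₃
  · rw [Equiv.swap_apply_left, Equiv.swap_apply_of_ne_of_ne (hne hIp₀ hIq₁).symm hq₀₁.symm, hIq₁, hIp₁,
      Equiv.swap_apply_left]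
  rcases eq_or_ne m q₁ with rfl | hm₄
  · rw [Equiv.swap_apply_right, Equiv.swap_apply_of_ne_of_ne hp₀₁.symm (hne hIp₁ hIq₀), hIp₁, hIq₁,
      Equiv.swap_apply_right]
  rw [Equiv.swap_apply_of_ne_of_ne hm₃ hm₄]
  rcases eq_or_ne m p₀ with rfl | hm₅
  · rw [Equiv.swap_apply_left, hIq₀, hIp₀, Equiv.swap_apply_left]
  rcases eq_or_ne m q₀ with rfl | hm₆
  · rw [Equiv.swap_apply_right, hIp₀, hIq₀, Equiv.swap_apply_right]
  rw [Equiv.swap_apply_of_ne_of_ne hm₅ hm₆]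
  have hmx : I m ≠ x := fun h => by
    rcases (hx m).1 h with h' | h' | h'
    · exact hm₅ h'
    · exact hm₃ h'
    · exact hm₁ h'
  have hmy : I m ≠ y := fun h => by
    rcases (hy m).1 h with h' | h' | h'
    · exact hm₆ h'
    · exact hm₄ h'
    · exact hm₂ h'
  rw [Equiv.swap_apply_of_ne_of_ne hmx hmy]

/-! ## §2  A tableau with three columns: exchanging two letters that fill one cell of each column flips the sign -/

/-- **Sign flip.** Let `T` be a standard tableau and let the letters `x ≠ y` have exactly three preimages each under
`I`, one in each of the columns `0, 1, 2` of `T`.  Then exchanging `x ↔ y` is composing `I` with three same-column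
transpositions of `T`, so the elementary pairing `⟨⊗_m M_{I m}, e_T⟩ = ∑_u (∏_m M (u m) (I m)) e_T(u)` changes sign
(`(−1)³`, tree `sum_prod_mul_polytabloid_comp_swap`). [cite: BurgisserIkenmeyer2011, Lemma 6.1 (the mechanism)]
[cite: BurgisserIkenmeyer2013, §4.2 (4.2)] -/
theorem threeCol_pairing_letterSwap {d r : ℕ} {Y : YoungDiagram} (hN : ∀ c ∈ Y.cells, c.1 < r)
    (T : StdFilling d Y) (M : Matrix (Fin r) (Fin r) ℂ) (I : Fin d → Fin r) {x y : Fin r} (hxy : x ≠ y)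
    (hx : ∃ p₀ p₁ p₂ : Fin d, (∀ m, I m = x ↔ (m = p₀ ∨ m = p₁ ∨ m = p₂)) ∧
      (T.1 p₀).2 = 0 ∧ (T.1 p₁).2 = 1 ∧ (T.1 p₂).2 = 2)
    (hy : ∃ q₀ q₁ q₂ : Fin d, (∀ m, I m = y ↔ (m = q₀ ∨ m = q₁ ∨ m = q₂)) ∧
      (T.1 q₀).2 = 0 ∧ (T.1 q₁).2 = 1 ∧ (T.1 q₂).2 = 2) :
    ∑ u : Word r d, (∏ m, M (u m) ((⇑(Equiv.swap x y) ∘ I) m)) * T.polytabloid ℂ hN u =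
      -∑ u : Word r d, (∏ m, M (u m) (I m)) * T.polytabloid ℂ hN u := by
  obtain ⟨p₀, p₁, p₂, hfx, hp₀, hp₁, hp₂⟩ := hx
  obtain ⟨q₀, q₁, q₂, hfy, hq₀, hq₁, hq₂⟩ := hy
  have hp₀₁ : p₀ ≠ p₁ := fun h => by rw [h] at hp₀; omega
  have hp₀₂ : p₀ ≠ p₂ := fun h => by rw [h] at hp₀; omega
  have hp₁₂ : p₁ ≠ p₂ := fun h => by rw [h] at hp₁; omega
  have hq₀₁ : q₀ ≠ q₁ := fun h => by rw [h] at hq₀; omega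
  have hq₀₂ : q₀ ≠ q₂ := fun h => by rw [h] at hq₀; omega
  have hq₁₂ : q₁ ≠ q₂ := fun h => by rw [h] at hq₁; omega
  have hIp₀ : I p₀ = x := (hfx p₀).2 (Or.inl rfl)
  have hIp₁ : I p₁ = x := (hfx p₁).2 (Or.inr (Or.inl rfl))
  have hIp₂ : I p₂ = x := (hfx p₂).2 (Or.inr (Or.inr rfl))
  have hIq₀ : I q₀ = y := (hfy q₀).2 (Or.inl rfl)
  have hIq₁ : I q₁ = y := (hfy q₁).2 (Or.inr (Or.inl rfl))
  have hIq₂ : I q₂ = y := (hfy q₂).2 (Or.inr (Or.inr rfl))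
  have hne : ∀ {p q : Fin d}, I p = x → I q = y → p ≠ q := fun hp hq h => hxy (by rw [← hp, h, hq])
  rw [swap_comp_eq_comp_swap_three I hxy hp₀₁ hp₀₂ hp₁₂ hq₀₁ hq₀₂ hq₁₂ hfx hfy]
  have h2 := sum_prod_mul_polytabloid_comp_swap hN T (hne hIp₂ hIq₂) (hp₂.trans hq₂.symm) M
    (I ∘ ⇑(Equiv.swap p₀ q₀) ∘ ⇑(Equiv.swap p₁ q₁))
  have h1 := sum_prod_mul_polytabloid_comp_swap hN T (hne hIp₁ hIq₁) (hp₁.trans hq₁.symm) M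
    (I ∘ ⇑(Equiv.swap p₀ q₀))
  have h0 := sum_prod_mul_polytabloid_comp_swap hN T (hne hIp₀ hIq₀) (hp₀.trans hq₀.symm) M I
  simp only [Function.comp_apply] at h2 h1 h0 ⊢
  rw [h2, h1, h0, neg_neg]

/-- **Column-sorted fibres.** If `I` is injective on the columns of a standard tableau `T` with (at most) three
columns and the letter `ℓ` has exactly three preimages, then it has one preimage in each of the columns `0, 1, 2`.
[folklore] -/
theorem exists_colSorted_fibre {d r : ℕ} {Y : YoungDiagram} (T : StdFilling d Y) (hT : ∀ p, (T.1 p).2 < 3)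
    (I : Fin d → Fin r) (hinj : ∀ p q, p ≠ q → (T.1 p).2 = (T.1 q).2 → I p ≠ I q) (ℓ : Fin r)
    (h3 : (Finset.univ.filter fun m => I m = ℓ).card = 3) :
    ∃ p₀ p₁ p₂ : Fin d, (∀ m, I m = ℓ ↔ (m = p₀ ∨ m = p₁ ∨ m = p₂)) ∧
      (T.1 p₀).2 = 0 ∧ (T.1 p₁).2 = 1 ∧ (T.1 p₂).2 = 2 := by
  classical
  set S := Finset.univ.filter fun m => I m = ℓ with hS_def
  have mem_S : ∀ {m}, m ∈ S ↔ I m = ℓ := by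
    intro m
    simp [hS_def]
  -- the column map is injective on `S` and lands in `{0, 1, 2}`
  have hinjS : Set.InjOn (fun p => (T.1 p).2) (S : Set (Fin d)) := by
    intro p hp q hq hc
    by_contra hpq
    exact hinj p q hpq hc ((mem_S.1 hp).trans (mem_S.1 hq).symm)
  have himg : S.image (fun p => (T.1 p).2) = Finset.range 3 := by
    refine Finset.eq_of_subset_of_card_le (fun c hc => ?_) ?_
    · obtain ⟨p, -, rfl⟩ := Finset.mem_image.1 hc
      exact Finset.mem_range.2 (hT p)
    · rw [Finset.card_range, Finset.card_image_of_injOn hinjS, h3]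
  have hcol : ∀ c, c < 3 → ∃ p, I p = ℓ ∧ (T.1 p).2 = c := by
    intro c hc
    have hc' : c ∈ S.image (fun p => (T.1 p).2) := by
      rw [himg]
      exact Finset.mem_range.2 hc
    obtain ⟨p, hp, hpc⟩ := Finset.mem_image.1 hc'
    exact ⟨p, mem_S.1 hp, hpc⟩
  obtain ⟨p₀, hI₀, hc₀⟩ := hcol 0 (by norm_num)
  obtain ⟨p₁, hI₁, hc₁⟩ := hcol 1 (by norm_num)
  obtain ⟨p₂, hI₂, hc₂⟩ := hcol 2 (by norm_num)
  have hp₀₁ : p₀ ≠ p₁ := fun h => by rw [h] at hc₀; omega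
  have hp₀₂ : p₀ ≠ p₂ := fun h => by rw [h] at hc₀; omega
  have hp₁₂ : p₁ ≠ p₂ := fun h => by rw [h] at hc₁; omega
  have hsub : ({p₀, p₁, p₂} : Finset (Fin d)) ⊆ S := by
    intro m hm
    simp only [Finset.mem_insert, Finset.mem_singleton] at hm
    rcases hm with rfl | rfl | rfl
    · exact mem_S.2 hI₀
    · exact mem_S.2 hI₁
    · exact mem_S.2 hI₂
  have hcard : ({p₀, p₁, p₂} : Finset (Fin d)).card = 3 :=
    Finset.card_eq_three.2 ⟨p₀, p₁, p₂, hp₀₁, hp₀₂, hp₁₂, rfl⟩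
  have hSeq : ({p₀, p₁, p₂} : Finset (Fin d)) = S :=
    Finset.eq_of_subset_of_card_le hsub (by rw [hcard, h3])
  refine ⟨p₀, p₁, p₂, fun m => ⟨fun hm => ?_, fun hm => ?_⟩, hc₀, hc₁, hc₂⟩
  · have hmS : m ∈ ({p₀, p₁, p₂} : Finset (Fin d)) := by
      rw [hSeq]
      exact mem_S.2 hm
    simpa only [Finset.mem_insert, Finset.mem_singleton] using hmS
  · rcases hm with rfl | rfl | rfl
    · exact hI₀
    · exact hI₁
    · exact hI₂

/-! ## §3  A sign-reversing involution given by exchanging two letters -/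

/-- **Letter-exchange involution.** Let `F` be a function of label maps `I : [d] → [r]` and `G I` a set of letters
("good letters of `I`") such that: exchanging two good letters `x ≠ y` preserves the set of good letters and negates
`F`; good letters are values of `I`; and every `I` with `F I ≠ 0` has two distinct good letters.  Then `∑_I F I = 0`
— the exchange of a chosen pair of good letters (the choice depending only on the set `G I`) is a fixed-point-free
involution on the support of `F` reversing the sign (`Finset.sum_involution`).  (Same plumbing as the tree's proof of
BI 2011 Lemma 6.1, where it is private.) [folklore] -/
theorem sum_eq_zero_of_letterSwap_invol {d r : ℕ} (F : (Fin d → Fin r) → ℂ) (G : (Fin d → Fin r) → Fin r → Prop)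
    (hG : ∀ I (x y : Fin r), x ≠ y → G I x → G I y → ∀ ℓ, G (⇑(Equiv.swap x y) ∘ I) ℓ ↔ G I ℓ)
    (hflip : ∀ I (x y : Fin r), x ≠ y → G I x → G I y → F (⇑(Equiv.swap x y) ∘ I) = -F I)
    (himg : ∀ I x, G I x → ∃ m, I m = x)
    (hsupp : ∀ I, F I ≠ 0 → ∃ x y, x ≠ y ∧ G I x ∧ G I y) :
    ∑ I, F I = 0 := by
  classical
  -- the chosen pair depends only on the predicate `G I`
  have key : ∀ (P P' : Fin r → Prop) (_ : P = P') (h : ∃ x y, x ≠ y ∧ P x ∧ P y)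
      (h' : ∃ x y, x ≠ y ∧ P' x ∧ P' y),
      Equiv.swap h.choose h.choose_spec.choose = Equiv.swap h'.choose h'.choose_spec.choose := by
    intro P P' e h h'
    subst e
    rfl
  have hmem : ∀ {I}, I ∈ (Finset.univ.filter fun I => F I ≠ 0) → F I ≠ 0 := fun hI =>
    (Finset.mem_filter.1 hI).2
  rw [← Finset.sum_filter_ne_zero]
  refine Finset.sum_involution
    (fun I hI => ⇑(Equiv.swap (hsupp I (hmem hI)).choose
      (hsupp I (hmem hI)).choose_spec.choose) ∘ I) ?_ ?_ ?_ ?_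
  · -- `F I + F (g I) = 0`
    intro I hI
    obtain ⟨hxy, hGx, hGy⟩ := (hsupp I (hmem hI)).choose_spec.choose_spec
    rw [hflip I _ _ hxy hGx hGy, add_neg_cancel]
  · -- `g I ≠ I`
    intro I hI _ hEq
    obtain ⟨hxy, hGx, -⟩ := (hsupp I (hmem hI)).choose_spec.choose_spec
    obtain ⟨m, hm⟩ := himg I _ hGx
    have h := congrFun hEq m
    simp only [Function.comp_apply, hm, Equiv.swap_apply_left] at h
    exact hxy h.symm
  · -- `g I` stays in the support
    intro I hI
    obtain ⟨hxy, hGx, hGy⟩ := (hsupp I (hmem hI)).choose_spec.choose_spec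
    refine Finset.mem_filter.2 ⟨Finset.mem_univ _, ?_⟩
    rw [hflip I _ _ hxy hGx hGy, neg_ne_zero]
    exact hmem hI
  · -- `g (g I) = I`: the same pair is chosen for `g I`
    intro I hI
    obtain ⟨hxy, hGx, hGy⟩ := (hsupp I (hmem hI)).choose_spec.choose_spec
    set x := (hsupp I (hmem hI)).choose with hx_def
    set y := (hsupp I (hmem hI)).choose_spec.choose with hy_def
    have hI' : ⇑(Equiv.swap x y) ∘ I ∈ Finset.univ.filter fun I => F I ≠ 0 := by
      refine Finset.mem_filter.2 ⟨Finset.mem_univ _, ?_⟩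
      rw [hflip I _ _ hxy hGx hGy, neg_ne_zero]
      exact hmem hI
    have e : G (⇑(Equiv.swap x y) ∘ I) = G I :=
      funext fun ℓ => propext (hG I x y hxy hGx hGy ℓ)
    have hk := key _ _ e (hsupp _ (hmem hI')) (hsupp I (hmem hI))
    show ⇑(Equiv.swap (hsupp _ (hmem hI')).choose (hsupp _ (hmem hI')).choose_spec.choose) ∘
      (⇑(Equiv.swap x y) ∘ I) = I
    rw [hk]
    funext m
    exact Equiv.swap_apply_self _ _ _

end Summit.MatrixMultiplication.MatrixMultiplication.Theorems.ObstructionCalculus
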